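import Summits.CriticalPhenomena.PercolationContinuityZ3.Theorems.PercNearOneGluingNoHeavyLowerTailMajorityGluingQCertVec
import Summits.CriticalPhenomena.PercolationContinuityZ3.Theorems.PercNearOneGluingNoHeavyLowerTailMajorityGluingQCertSevenFiveA
import Summits.CriticalPhenomena.PercolationContinuityZ3.Theorems.PercNearOneGluingNoHeavyLowerTailMajorityGluingQCertSevenFiveB
import Summits.CriticalPhenomena.PercolationContinuityZ3.Theorems.PercNearOneGluingNoHeavyLowerTailMajorityGluingQCertSevenFiveC
import HarnessLib

/-!
# The `(7,5)` certificate with constant `61/50`: assembly, structural check, quadratic check on the rows `[0, 48)` (lane prim-rate, constants-miner 1, gen 34; CANDIDATES §GEN-34 R327)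

Support file for the closed crux `NoHeavyLowerTail` (stmt-CriticalPhenomena-4575), majority-gluing line.  `sevenFive` assembles the certificate of `…QCertSevenFiveA/B/C`
(`m = 7`, `h = 5`, `cN/cD = 61/50`, case family `1`); `checkW` and the quadratic check on the first `48` of the `129` variable rows are evaluated here by
`decide +kernel` (≈ 20 + 2×32 s of kernel time; `maxHeartbeats 0` scoped to the closed evaluations), the remaining rows in `…QCertSevenFive2/3`, which also assembles
`sevenFive_check`.  No sorries.
-/

namespace Summit.CriticalPhenomena.PercolationContinuityZ3.Theorems

namespace HubOnly
namespace QCert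

/-- **The `(7,5)` certificate for the constant `61/50`** (mine-1 gen 34, kit j269835; integer translation by gen.py). -/
def sevenFive : Cert := ⟨7, 5, 61, 50, 1, sevenFiveLin, sevenFiveRowsB ++ sevenFiveRowsC, sevenFiveSqs⟩

set_option maxHeartbeats 0 in
/-- The structural check passes. -/
theorem sevenFive_checkW : sevenFive.checkW = true := by decide +kernel

set_option maxHeartbeats 0 in
/-- The quadratic check passes on the variable rows `[0, 24)`. -/
theorem sevenFive_checkQ_0 : sevenFive.checkQ 0 24 = true := by decide +kernel

set_option maxHeartbeats 0 in
/-- The quadratic check passes on the variable rows `[24, 48)`. -/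
theorem sevenFive_checkQ_24 : sevenFive.checkQ 24 48 = true := by decide +kernel

end QCert
end HubOnly

end Summit.CriticalPhenomena.PercolationContinuityZ3.Theorems
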